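import Mathlib
import Summits.Ventures.HodgeRepro.Tier4.Line1.RTFSetting
import Summits.Ventures.HodgeRepro.Tier4.Line1.GeneratedSubspace
import Summits.Ventures.HodgeRepro.Tier4.Line1.BlockSimple
import Summits.Ventures.HodgeRepro.Tier4.Line1.BlockConstituents

/-!
# Tier4/Line1/BlockDecomposition — (C-PROJ), part 2: THE PROJECTIONS of an `e`-fixed finite-dimensional block onto its
constituents and the statement `exists_block_decomposition` (plan-1's cut S14294 / S14303, TAKEN S14310; the `π i`,
`hπmem`, `hπsum`, `hπid`, `hπzero` and `idx` / `W` of p5's `IdempotentData` / this seat's `IdempotentData.ofIsotypic`)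

Blind re-derivation cell `pub-hodge-repro`, Tier 4 (README §9–§10), seat t4-L1-p3 (prover, LINE L1, gen 3).  Target tree
path `lean/Summits/Ventures/HodgeRepro/Tier4/Line1/BlockDecomposition.lean`.  Imports part 1 `BlockConstituents`
(`Wm`, `finite_support_Wm`, `iSup_Wm_eq`, …), p2's `GeneratedSubspace` (`R_add'`, `R_zero'`).  Paper proof:
proofs/t4/L1/C-PROJ-block-decomposition-t4-L1-p3.md §3.  0 printed inputs.

CONTENT.  `blockSupport` = the finite set `s` of constituents meeting the block; `constituentFamily : s → Submodule`; the
canonical map `⨁_{m ∈ s} Wm m → (G → ℂ)` is INJECTIVE (`coeLinearMap_constituentFamily_injective`: orthogonality +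
definiteness) with RANGE `Vb` (`range_coeLinearMap_constituentFamily`, from the heart); `blockDecomp` = the linear
equivalence `⨁_{m ∈ s} Wm m ≃ Vb`, `blockComp hψ i` = the `i`-th component of `ψ ∈ Vb`, **`blockComp_eq_of_sum`** = UNIQUENESS of
the decomposition (`ψ = ∑ w i`, `w i ∈ Wm i` ⇒ the components are the `w i`); `blockProj m` = the projection.
**`exists_block_decomposition`** (plan-1's S14294 with three binder re-cuts: `he_sym` added; clause 1 `P m ψ ∈ τ m` for
`m ∈ s` — for `m ∉ s` it would read `0 ∈ τ m`, false for an empty `τ m`; clause 7 for every `R(f)` that PRESERVES `Vb` —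
`R f ψ ∈ Vb` for the one `ψ` is not enough, the components `R f (P i ψ)` must lie in `Vb` too; the Hecke elements of type σ
preserve it, `R_mem_isotypicFixed`): a finite `s` and projections `P m` with `P m ψ ∈ Vb`; `P m ψ ∈ τ m` for `m ∈ s`;
additivity and homogeneity on `Vb`; `∑ m ∈ s, P m ψ = ψ`; identity on `Vb ∩ τ m`; zero on `Vb ∩ τ m'` (`m ≠ m'`);
commutation with every `R(f)` preserving `Vb` (by uniqueness of the decomposition, `R(f)` preserving each `τ m`); and
every constituent meeting `Vb` non-trivially is in `s`.  Nothing here moves (P); (C1)/(C2)/(C3) are elsewhere.  Nothing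
here says anything about the status of the Hodge conjecture for CM abelian varieties, which is NOT proved (HC_CM is NOT
proved by anyone in this repository).
-/

set_option autoImplicit false

noncomputable section

namespace Summit.Ventures.HodgeRepro.Tier4.Line1

open MeasureTheory Topology Set DirectSum

namespace RTF.Setting

variable {G : Type} [Group G] [TopologicalSpace G] [IsTopologicalGroup G] [MeasurableSpace G] [BorelSpace G]
  (S : Setting G)

section Decomposition

variable {τ : ℕ → Set (G → ℂ)} {φ : ℕ → G → ℂ} {n : ℕ → ℕ} (hB : S.IsAdaptedONB τ φ n)
  {e : G → ℂ} (Vb : Submodule ℂ (G → ℂ))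
  (hVb : ∀ ψ, ψ ∈ Vb ↔ S.Invariant ψ ∧ Continuous ψ ∧ S.R e ψ = ψ)

variable [Countable S.Gk] [SecondCountableTopology G] [T2Space G] [MeasurableMul G] [SFinite S.μ]
  [FiniteDimensional ℂ Vb] (he : IsTest e) (he_conv : S.conv e e = e) (he_sym : cj (refl e) = e)

/-- the FINITE set of constituents meeting the block. -/
def blockSupport : Finset ℕ := (S.finite_support_Wm hB Vb hVb).toFinset

omit [SecondCountableTopology G] [T2Space G] [MeasurableMul G] [SFinite S.μ] in
include hB hVb in
/-- membership in the support: the constituent is non-zero. -/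
theorem mem_blockSupport {m : ℕ} : m ∈ blockSupport S hB Vb hVb ↔ Wm S hB Vb m ≠ ⊥ := by
  simp [blockSupport]

/-- the constituents indexed by the support (the family of the direct sum). -/
def constituentFamily : ↥(blockSupport S hB Vb hVb) → Submodule ℂ (G → ℂ) := fun i => Wm S hB Vb i

omit [SecondCountableTopology G] [T2Space G] [MeasurableMul G] [SFinite S.μ] in
include hB hVb in
/-- `coeLinearMap` of the family is the sum of the components. -/
theorem coeLinearMap_constituentFamily_eq (x : ⨁ i, constituentFamily S hB Vb hVb i) :
    coeLinearMap (constituentFamily S hB Vb hVb) x = ∑ i, ((x i : constituentFamily S hB Vb hVb i) : G → ℂ) := by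
  conv_lhs => rw [← DirectSum.sum_univ_of x]
  rw [map_sum]
  simp only [coeLinearMap_of]

omit [SecondCountableTopology G] [T2Space G] [MeasurableMul G] [SFinite S.μ] in
include hB hVb in
/-- the canonical map `⨁_{m ∈ s} Wm m → (G → ℂ)` is injective (orthogonality + definiteness). -/
theorem coeLinearMap_constituentFamily_injective :
    Function.Injective (coeLinearMap (constituentFamily S hB Vb hVb)) := by
  rw [injective_iff_map_eq_zero]
  intro x hx
  rw [S.coeLinearMap_constituentFamily_eq hB Vb hVb] at hx
  refine DFinsupp.ext fun k => ?_
  rw [DirectSum.zero_apply]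
  have hpair : S.inner (∑ i, ((x i : constituentFamily S hB Vb hVb i) : G → ℂ))
      ((x k : constituentFamily S hB Vb hVb k) : G → ℂ) = 0 := by
    rw [hx, S.inner_zero_left]
  rw [S.inner_finset_sum_left'' Finset.univ (fun i => ((x i : constituentFamily S hB Vb hVb i) : G → ℂ))
    (fun i _ => S.continuous_of_mem_Vb Vb hVb (x i).2.1) (S.continuous_of_mem_Vb Vb hVb (x k).2.1)] at hpair
  have hterm : ∀ i ∈ (Finset.univ : Finset ↥(blockSupport S hB Vb hVb)),
      S.inner ((x i : constituentFamily S hB Vb hVb i) : G → ℂ) ((x k : constituentFamily S hB Vb hVb k) : G → ℂ)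
        = if i = k then S.inner ((x k : constituentFamily S hB Vb hVb k) : G → ℂ)
            ((x k : constituentFamily S hB Vb hVb k) : G → ℂ) else 0 := by
    intro i _
    by_cases hik : i = k
    · subst hik
      rw [if_pos rfl]
    · rw [if_neg hik]
      exact S.inner_Wm_eq_zero hB Vb (fun h => hik (Subtype.ext h)) (x i).2 (x k).2
  rw [Finset.sum_congr rfl hterm, Finset.sum_ite_eq' Finset.univ k, if_pos (Finset.mem_univ k)] at hpair
  exact Subtype.ext (S.eq_zero_of_inner_self_Vb Vb hVb (x k).2.1 hpair)

include hB he he_conv he_sym hVb in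
/-- the range of the canonical map is the block. -/
theorem range_coeLinearMap_constituentFamily :
    LinearMap.range (coeLinearMap (constituentFamily S hB Vb hVb)) = Vb := by
  have h1 : LinearMap.range (coeLinearMap (constituentFamily S hB Vb hVb))
      = ⨆ i, constituentFamily S hB Vb hVb i :=
    (Submodule.iSup_eq_range_dfinsupp_lsum _).symm
  have h2 : (⨆ i, constituentFamily S hB Vb hVb i) = ⨆ m, Wm S hB Vb m := by
    refine le_antisymm (iSup_le fun i => le_iSup (fun m => Wm S hB Vb m) (i : ℕ)) (iSup_le fun m => ?_)
    by_cases hm : m ∈ blockSupport S hB Vb hVb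
    · exact le_iSup (fun i : ↥(blockSupport S hB Vb hVb) => constituentFamily S hB Vb hVb i) ⟨m, hm⟩
    · have : Wm S hB Vb m = ⊥ := by
        by_contra h
        exact hm ((S.mem_blockSupport hB Vb hVb).mpr h)
      rw [this]
      exact bot_le
  rw [h1, h2, S.iSup_Wm_eq hB Vb hVb he he_conv he_sym]


/-- **the decomposition equivalence** `⨁_{m ∈ s} Wm m ≃ Vb` (as the range of the canonical map). -/
def blockDecomp : (⨁ i, constituentFamily S hB Vb hVb i) ≃ₗ[ℂ]
    LinearMap.range (coeLinearMap (constituentFamily S hB Vb hVb)) :=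
  LinearEquiv.ofInjective _ (S.coeLinearMap_constituentFamily_injective hB Vb hVb)

include he he_conv he_sym in
/-- every element of the block is in the range of the canonical map. -/
theorem mem_range_of_mem_Vb {ψ : G → ℂ} (hψ : ψ ∈ Vb) :
    ψ ∈ LinearMap.range (coeLinearMap (constituentFamily S hB Vb hVb)) := by
  rw [S.range_coeLinearMap_constituentFamily hB Vb hVb he he_conv he_sym]
  exact hψ

omit [SecondCountableTopology G] [T2Space G] [MeasurableMul G] [SFinite S.μ] in
include hB hVb in
/-- the decomposition of `coeLinearMap x` is `x`. -/
theorem blockDecomp_symm_coeLinearMap (x : ⨁ i, constituentFamily S hB Vb hVb i)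
    (h : coeLinearMap (constituentFamily S hB Vb hVb) x ∈ LinearMap.range (coeLinearMap (constituentFamily S hB Vb hVb))) :
    (blockDecomp S hB Vb hVb).symm ⟨coeLinearMap (constituentFamily S hB Vb hVb) x, h⟩ = x := by
  apply S.coeLinearMap_constituentFamily_injective hB Vb hVb
  rw [blockDecomp, LinearEquiv.ofInjective_symm_apply]

/-- the component of `ψ ∈ Vb` along the constituent `i ∈ s`. -/
def blockComp {ψ : G → ℂ} (hψ : ψ ∈ Vb) (i : ↥(blockSupport S hB Vb hVb)) : G → ℂ :=
  (((blockDecomp S hB Vb hVb).symm ⟨ψ, S.mem_range_of_mem_Vb hB Vb hVb he he_conv he_sym hψ⟩ i :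
    constituentFamily S hB Vb hVb i) : G → ℂ)

include he he_conv he_sym in
/-- the component lies in the constituent. -/
theorem blockComp_mem {ψ : G → ℂ} (hψ : ψ ∈ Vb) (i : ↥(blockSupport S hB Vb hVb)) :
    blockComp S hB Vb hVb he he_conv he_sym hψ i ∈ Wm S hB Vb i :=
  ((blockDecomp S hB Vb hVb).symm ⟨ψ, S.mem_range_of_mem_Vb hB Vb hVb he he_conv he_sym hψ⟩ i).2

include he he_conv he_sym in
/-- the components sum to `ψ`. -/
theorem sum_blockComp {ψ : G → ℂ} (hψ : ψ ∈ Vb) : ∑ i, blockComp S hB Vb hVb he he_conv he_sym hψ i = ψ := by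
  have h1 := S.coeLinearMap_constituentFamily_eq hB Vb hVb
    ((blockDecomp S hB Vb hVb).symm ⟨ψ, S.mem_range_of_mem_Vb hB Vb hVb he he_conv he_sym hψ⟩)
  have h2 : coeLinearMap (constituentFamily S hB Vb hVb)
      ((blockDecomp S hB Vb hVb).symm ⟨ψ, S.mem_range_of_mem_Vb hB Vb hVb he he_conv he_sym hψ⟩) = ψ := by
    rw [blockDecomp, LinearEquiv.ofInjective_symm_apply]
  calc ∑ i, blockComp S hB Vb hVb he he_conv he_sym hψ i
      = coeLinearMap (constituentFamily S hB Vb hVb)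
          ((blockDecomp S hB Vb hVb).symm ⟨ψ, S.mem_range_of_mem_Vb hB Vb hVb he he_conv he_sym hψ⟩) := h1.symm
    _ = ψ := h2

include he he_conv he_sym in
/-- **UNIQUENESS of the decomposition**: if `ψ = ∑ i, w i` with `w i ∈ Wm i`, the components of `ψ` are the `w i`. -/
theorem blockComp_eq_of_sum {ψ : G → ℂ} (hψ : ψ ∈ Vb) (w : ↥(blockSupport S hB Vb hVb) → G → ℂ)
    (hw : ∀ i, w i ∈ constituentFamily S hB Vb hVb i) (hsum : ψ = ∑ i, w i)
    (k : ↥(blockSupport S hB Vb hVb)) : blockComp S hB Vb hVb he he_conv he_sym hψ k = w k := by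
  set y : ⨁ i, constituentFamily S hB Vb hVb i :=
    DFinsupp.equivFunOnFintype.symm (fun i => (⟨w i, hw i⟩ : constituentFamily S hB Vb hVb i)) with hy
  have hyk : ∀ i, y i = ⟨w i, hw i⟩ := fun i => by
    rw [hy]
    exact congrFun ((DFinsupp.equivFunOnFintype (β := fun i => constituentFamily S hB Vb hVb i)).apply_symm_apply
      (fun i => (⟨w i, hw i⟩ : constituentFamily S hB Vb hVb i))) i
  have hcoe : coeLinearMap (constituentFamily S hB Vb hVb) y = ψ := by
    rw [S.coeLinearMap_constituentFamily_eq hB Vb hVb, hsum]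
    exact Finset.sum_congr rfl fun i _ => by rw [hyk i]
  have hsymm : (blockDecomp S hB Vb hVb).symm ⟨ψ, S.mem_range_of_mem_Vb hB Vb hVb he he_conv he_sym hψ⟩ = y := by
    have := S.blockDecomp_symm_coeLinearMap hB Vb hVb y
      (by rw [hcoe]; exact S.mem_range_of_mem_Vb hB Vb hVb he he_conv he_sym hψ)
    convert this using 2
    exact Subtype.ext hcoe.symm
  unfold blockComp
  rw [hsymm, hyk k]


open Classical in
/-- **THE PROJECTION onto the `m`-th constituent** (`0` off `Vb` and off the support `s`). -/
def blockProj (m : ℕ) (ψ : G → ℂ) : G → ℂ :=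
  if hψ : ψ ∈ Vb then
    (if hm : m ∈ blockSupport S hB Vb hVb then blockComp S hB Vb hVb he he_conv he_sym hψ ⟨m, hm⟩ else 0)
  else 0

include he he_conv he_sym in
/-- the projection on the block, at an index of the support, is the component. -/
theorem blockProj_of_mem {m : ℕ} {ψ : G → ℂ} (hψ : ψ ∈ Vb) (hm : m ∈ blockSupport S hB Vb hVb) :
    blockProj S hB Vb hVb he he_conv he_sym m ψ = blockComp S hB Vb hVb he he_conv he_sym hψ ⟨m, hm⟩ := by
  unfold blockProj
  rw [dif_pos hψ, dif_pos hm]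

include he he_conv he_sym in
/-- the projection vanishes off the support. -/
theorem blockProj_of_not_mem_support {m : ℕ} (ψ : G → ℂ) (hm : m ∉ blockSupport S hB Vb hVb) :
    blockProj S hB Vb hVb he he_conv he_sym m ψ = 0 := by
  unfold blockProj
  by_cases hψ : ψ ∈ Vb
  · rw [dif_pos hψ, dif_neg hm]
  · rw [dif_neg hψ]

include he he_conv he_sym in
/-- the components lie in the block. -/
theorem blockComp_mem_Vb {ψ : G → ℂ} (hψ : ψ ∈ Vb) (i : ↥(blockSupport S hB Vb hVb)) :
    blockComp S hB Vb hVb he he_conv he_sym hψ i ∈ Vb :=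
  (S.blockComp_mem hB Vb hVb he he_conv he_sym hψ i).1

include hB he he_conv he_sym hVb in
/-- **(C-PROJ) THE DECOMPOSITION OF THE BLOCK ALONG THE CONSTITUENTS** (plan-1's S14294, binders re-cut: `he_sym` added;
clause 1 for `m ∈ s`; clause 7 for `R(f)` preserving `Vb`).  There are a finite set `s` of constituents and projections
`P m` with: `P m ψ ∈ Vb`; `P m ψ ∈ τ m` for `m ∈ s`; additive and homogeneous on `Vb`; `∑ m ∈ s, P m ψ = ψ`; the identity on
`Vb ∩ τ m`; zero on `Vb ∩ τ m'` for `m ≠ m'`; commuting with every `R(f)` (`f` a test function) that preserves `Vb`;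
and every constituent meeting `Vb` non-trivially is in `s`. -/
theorem exists_block_decomposition :
    ∃ (s : Finset ℕ) (P : ℕ → (G → ℂ) → (G → ℂ)),
      (∀ m, ∀ ψ ∈ Vb, P m ψ ∈ Vb) ∧
      (∀ m ∈ s, ∀ ψ ∈ Vb, P m ψ ∈ τ m) ∧
      (∀ m, ∀ ψ ∈ Vb, ∀ ψ' ∈ Vb, P m (ψ + ψ') = P m ψ + P m ψ') ∧
      (∀ m, ∀ ψ ∈ Vb, ∀ c : ℂ, P m (c • ψ) = c • P m ψ) ∧
      (∀ ψ ∈ Vb, ∑ m ∈ s, P m ψ = ψ) ∧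
      (∀ m, ∀ ψ ∈ Vb, ψ ∈ τ m → P m ψ = ψ) ∧
      (∀ m m', m ≠ m' → ∀ ψ ∈ Vb, ψ ∈ τ m' → P m ψ = 0) ∧
      (∀ m, ∀ f, IsTest f → (∀ ψ ∈ Vb, S.R f ψ ∈ Vb) → ∀ ψ ∈ Vb, P m (S.R f ψ) = S.R f (P m ψ)) ∧
      (∀ m, (∃ ψ ∈ Vb, ψ ∈ τ m ∧ ψ ≠ 0) → m ∈ s) := by
  classical
  refine ⟨blockSupport S hB Vb hVb, blockProj S hB Vb hVb he he_conv he_sym, ?_, ?_, ?_, ?_, ?_, ?_, ?_, ?_, ?_⟩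
  -- (a) into the block
  · intro m ψ hψ
    by_cases hm : m ∈ blockSupport S hB Vb hVb
    · rw [S.blockProj_of_mem hB Vb hVb he he_conv he_sym hψ hm]
      exact S.blockComp_mem_Vb hB Vb hVb he he_conv he_sym hψ _
    · rw [S.blockProj_of_not_mem_support hB Vb hVb he he_conv he_sym ψ hm]
      exact Vb.zero_mem
  -- (a') into the constituent, on the support
  · intro m hm ψ hψ
    rw [S.blockProj_of_mem hB Vb hVb he he_conv he_sym hψ hm]
    rcases (S.blockComp_mem hB Vb hVb he he_conv he_sym hψ ⟨m, hm⟩).2 with h | h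
    · exact h
    · rw [h]
      exact S.zero_mem_tau_of_Wm_ne_bot hB Vb ((S.mem_blockSupport hB Vb hVb).mp hm)
  -- (b) additive
  · intro m ψ hψ ψ' hψ'
    by_cases hm : m ∈ blockSupport S hB Vb hVb
    · rw [S.blockProj_of_mem hB Vb hVb he he_conv he_sym (Vb.add_mem hψ hψ') hm,
        S.blockProj_of_mem hB Vb hVb he he_conv he_sym hψ hm, S.blockProj_of_mem hB Vb hVb he he_conv he_sym hψ' hm]
      refine S.blockComp_eq_of_sum hB Vb hVb he he_conv he_sym (Vb.add_mem hψ hψ')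
        (fun i => blockComp S hB Vb hVb he he_conv he_sym hψ i + blockComp S hB Vb hVb he he_conv he_sym hψ' i)
        (fun i => (constituentFamily S hB Vb hVb i).add_mem (S.blockComp_mem hB Vb hVb he he_conv he_sym hψ i)
          (S.blockComp_mem hB Vb hVb he he_conv he_sym hψ' i)) ?_ ⟨m, hm⟩
      rw [Finset.sum_add_distrib, S.sum_blockComp hB Vb hVb he he_conv he_sym hψ,
        S.sum_blockComp hB Vb hVb he he_conv he_sym hψ']
    · simp only [S.blockProj_of_not_mem_support hB Vb hVb he he_conv he_sym _ hm, add_zero]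
  -- (c) homogeneous
  · intro m ψ hψ c
    by_cases hm : m ∈ blockSupport S hB Vb hVb
    · rw [S.blockProj_of_mem hB Vb hVb he he_conv he_sym (Vb.smul_mem c hψ) hm,
        S.blockProj_of_mem hB Vb hVb he he_conv he_sym hψ hm]
      refine S.blockComp_eq_of_sum hB Vb hVb he he_conv he_sym (Vb.smul_mem c hψ)
        (fun i => c • blockComp S hB Vb hVb he he_conv he_sym hψ i)
        (fun i => (constituentFamily S hB Vb hVb i).smul_mem c (S.blockComp_mem hB Vb hVb he he_conv he_sym hψ i))
        ?_ ⟨m, hm⟩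
      rw [← Finset.smul_sum, S.sum_blockComp hB Vb hVb he he_conv he_sym hψ]
    · simp only [S.blockProj_of_not_mem_support hB Vb hVb he he_conv he_sym _ hm, smul_zero]
  -- (d) the sum of the projections is the identity
  · intro ψ hψ
    rw [← Finset.sum_coe_sort (blockSupport S hB Vb hVb) (fun m => blockProj S hB Vb hVb he he_conv he_sym m ψ)]
    have : ∀ i : ↥(blockSupport S hB Vb hVb),
        blockProj S hB Vb hVb he he_conv he_sym (i : ℕ) ψ = blockComp S hB Vb hVb he he_conv he_sym hψ i := fun i => by
      rw [S.blockProj_of_mem hB Vb hVb he he_conv he_sym hψ i.2]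
    simp only [this]
    exact S.sum_blockComp hB Vb hVb he he_conv he_sym hψ
  -- (e) the identity on `Vb ∩ τ m`
  · intro m ψ hψ hτ
    by_cases hm : m ∈ blockSupport S hB Vb hVb
    · rw [S.blockProj_of_mem hB Vb hVb he he_conv he_sym hψ hm]
      have := S.blockComp_eq_of_sum hB Vb hVb he he_conv he_sym hψ
        (fun i => if i = ⟨m, hm⟩ then ψ else 0)
        (fun i => by
          by_cases hi : i = ⟨m, hm⟩
          · rw [if_pos hi, hi]
            exact ⟨hψ, Or.inl hτ⟩
          · rw [if_neg hi]
            exact (constituentFamily S hB Vb hVb i).zero_mem)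
        (by simp) ⟨m, hm⟩
      rw [this, if_pos rfl]
    · have hbot : Wm S hB Vb m = ⊥ := by
        by_contra h
        exact hm ((S.mem_blockSupport hB Vb hVb).mpr h)
      have hψ0 : ψ = 0 := by
        have : ψ ∈ Wm S hB Vb m := ⟨hψ, Or.inl hτ⟩
        rw [hbot, Submodule.mem_bot] at this
        exact this
      rw [S.blockProj_of_not_mem_support hB Vb hVb he he_conv he_sym ψ hm, hψ0]
  -- (f) zero on `Vb ∩ τ m'`, `m ≠ m'`
  · intro m m' hmm ψ hψ hτ'
    by_cases hm : m ∈ blockSupport S hB Vb hVb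
    · by_cases hm' : m' ∈ blockSupport S hB Vb hVb
      · rw [S.blockProj_of_mem hB Vb hVb he he_conv he_sym hψ hm]
        have := S.blockComp_eq_of_sum hB Vb hVb he he_conv he_sym hψ
          (fun i => if i = ⟨m', hm'⟩ then ψ else 0)
          (fun i => by
            by_cases hi : i = ⟨m', hm'⟩
            · rw [if_pos hi, hi]
              exact ⟨hψ, Or.inl hτ'⟩
            · rw [if_neg hi]
              exact (constituentFamily S hB Vb hVb i).zero_mem)
          (by simp) ⟨m, hm⟩
        rw [this, if_neg]
        intro h
        exact hmm (congrArg Subtype.val h)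
      · have hbot : Wm S hB Vb m' = ⊥ := by
          by_contra h
          exact hm' ((S.mem_blockSupport hB Vb hVb).mpr h)
        have hψ0 : ψ = 0 := by
          have : ψ ∈ Wm S hB Vb m' := ⟨hψ, Or.inl hτ'⟩
          rw [hbot, Submodule.mem_bot] at this
          exact this
        rw [hψ0, S.blockProj_of_mem hB Vb hVb he he_conv he_sym Vb.zero_mem hm]
        exact S.blockComp_eq_of_sum hB Vb hVb he he_conv he_sym Vb.zero_mem (fun _ => 0)
          (fun i => (constituentFamily S hB Vb hVb i).zero_mem) (by simp) ⟨m, hm⟩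
    · exact S.blockProj_of_not_mem_support hB Vb hVb he he_conv he_sym ψ hm
  -- (g) commutation with every `R(f)` preserving the block
  · intro m f hf hpres ψ hψ
    by_cases hm : m ∈ blockSupport S hB Vb hVb
    · rw [S.blockProj_of_mem hB Vb hVb he he_conv he_sym (hpres ψ hψ) hm,
        S.blockProj_of_mem hB Vb hVb he he_conv he_sym hψ hm]
      refine S.blockComp_eq_of_sum hB Vb hVb he he_conv he_sym (hpres ψ hψ)
        (fun i => S.R f (blockComp S hB Vb hVb he he_conv he_sym hψ i)) ?_ ?_ ⟨m, hm⟩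
      · intro i
        refine ⟨hpres _ (S.blockComp_mem_Vb hB Vb hVb he he_conv he_sym hψ i), ?_⟩
        rcases (S.blockComp_mem hB Vb hVb he he_conv he_sym hψ i).2 with h | h
        · exact Or.inl ((hB.inv i).conv _ h f hf)
        · rw [h, S.R_zero']
          exact Or.inr rfl
      · conv_lhs => rw [← S.sum_blockComp hB Vb hVb he he_conv he_sym hψ]
        exact S.R_finset_sum' Finset.univ hf _ fun i _ =>
          S.continuous_of_mem_Vb Vb hVb (S.blockComp_mem_Vb hB Vb hVb he he_conv he_sym hψ i)
    · rw [S.blockProj_of_not_mem_support hB Vb hVb he he_conv he_sym _ hm,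
        S.blockProj_of_not_mem_support hB Vb hVb he he_conv he_sym _ hm, S.R_zero']
  -- (h) every constituent meeting the block is in the support
  · rintro m ⟨ψ, hψ, hτ, hne⟩
    rw [S.mem_blockSupport hB Vb hVb]
    exact (Submodule.ne_bot_iff _).mpr ⟨ψ, ⟨hψ, Or.inl hτ⟩, hne⟩

end Decomposition

end RTF.Setting

end Summit.Ventures.HodgeRepro.Tier4.Line1
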